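import Summits.ABC.IUTFork.Joshi.TestGenuinePinsDividingLine
import Summits.ABC.IUTFork.Joshi.TestGenuinePinsVacuityQuadraticField
import Literature.IUT.LogVolume.DifferentOrdHenselBound
import Literature.IUT.LogVolume.DistinguishedPrimesBoundGalois
import HarnessLib

/-!
# Branch E TEST — the DISCRIMINANT of a number field with inhabited genuine-carrier pins (R-J row Y-26): `d_F² ≤ 24^[F:ℚ]`,
# `d_F² ≤ 3^[F:ℚ]` when `2` is unramified, hence «every `F ≠ ℚ` in which `2` is unramified has EMPTY pins»

Proof-only sequel (abc-iut cell, D-0079 R-J «Joshi Y-discharge census», row Y-26; seat abc-iut-E-t41, gen 4; 0 definitions, no `Prop`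
fact, FACT rows used: none) to this seat's `Joshi/TestGenuinePinsDividingLine.lean` (p489924: `PinnedRegions` at abc-iut-c312-7's
`settingPrVolSharp` over `LatticeSituation.ofShells (logShellsDH X (analyticLogv F)) …` ⇒ every finite place of `F` is unramified, or a
`(2,1)`-place over `3` (`ℚ_3(ζ_3)`-shape), or a `(2,1)`-place over `2` (`ℚ_2(√3)`-shape)).  It supplies the ARITHMETIC HALF of E-ROW R-23
(«Y-26 kernel ceiling lift», holder abc-iut-f-072: the Minkowski half) — an UPPER bound on `|d_F|` from the pins — and the corollary that
needs only Mathlib's weak Minkowski bound: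

* `GenuinePinsDiscriminant.exists_natAbs_discr_le` (pure number-field arithmetic): if every finite place of `F` is unramified or a
  `(2,1)`-place over `3` or over `2`, then `|d_F| ≤ 3^a·8^b` with `2a ≤ [F:ℚ]`, `2b ≤ [F:ℚ]`, and `b = 0` when `2` is unramified —
  `|d_F| = N(𝔇_{F/ℤ})` (Mathlib `NumberField.absNorm_differentIdeal`), `N(𝔇) = ∏_v N(v)^{ord_v 𝔇}` (Mathlib
  `Ideal.finprod_heightOneSpectrum_pow_multiplicity`, the tree's `ADivisor.degF_ofIdeal` pattern), `ord_v 𝔇 > 0 ⇒ e(v) ≥ 2` (tree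
  `two_le_ramificationIdx_int_of_multiplicity_pos`), the GLOBAL Dedekind–Hensel bound `ord_v 𝔇 + 1 ≤ e·(v_p(e) + 1)` (tree
  `multiplicity_differentIdeal_int_succ_le`: `≤ 1` at a tame `(2,1)`-place over `3`, `≤ 3` at a wild `(2,1)`-place over `2`),
  `N(v) = p^f` (tree `absNorm_eq_pow_inertiaDeg`), and `Σ_{v ∣ p} e_v f_v = [F:ℚ]` (tree `sum_localDeg`);
* **`natAbs_discr_sq_le_of_pinnedRegions_settingPrVolSharp`** — pins ⇒ `d_F² ≤ 24^[F:ℚ]` (root discriminant `≤ √24`; the input of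
  R-23's sharp-Minkowski ceiling: the exact dyadic exponent `2` of `ℚ_2(√3)` is NOT claimed — only Hensel's `≤ 3`);
* **`natAbs_discr_sq_le_three_pow_of_pinnedRegions_settingPrVolSharp`** — pins and `2` unramified in `F` ⇒ `d_F² ≤ 3^[F:ℚ]`;
* `GenuinePinsDiscriminant.three_pow_lt_natAbs_discr_sq` — Mathlib's WEAK Minkowski bound `NumberField.abs_discr_ge`
  (`(4/9)(3π/4)^n ≤ |d_F|`) squared beats `3^n` for `n ≥ 3` (`(3π/4)² > 5.5`, `(11/6)³ > 81/16`);
* **`not_pinnedRegions(3)_settingPrVolSharp_of_unramified_two`** — EVERY number field `F ≠ ℚ` in which `2` is UNRAMIFIED (`e(v|2) = 1`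
  at every `v ∣ 2`) has KERNEL-EMPTY pins at the genuine carrier, in EVERY degree (`[F:ℚ] = 2`: abc-iut-E-t43's p461949; `≥ 3`: the two
  items above); **`…_of_not_two_dvd_discr`** — the same for every `F ≠ ℚ` with ODD discriminant (Dedekind, Mathlib
  `NumberField.not_dvd_discr_iff_forall_mem` + `Ideal.ramificationIdx_eq_one_iff`).

CONSEQUENCE FOR THE RECORD (tree currency, no side taken): the kernel residual class of row Y-26 («`F ≠ ℚ`, every ramified place
`ℚ_3(ζ_3)`- or `ℚ_2(√3)`-shaped, no quadratic subfield», abc-iut-E-cx-2 03:31:46Z) loses its whole WILD-FREE half: a residual `F ≠ ℚ` must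
have a `ℚ_2(√3)`-shaped (wildly ramified) dyadic place, and `d_F² ≤ 24^[F:ℚ]`.  HONEST SCOPE: OUR interface, OUR sharp real container,
Dupuy–Hilado's reading of (Ind2); nothing here bears on print's (xi-e)/(xi-f); locates / conditionally verifies; no abc claim.
[claim: Mochizuki2012, status: disputed] [cite: DupuyHilado2025, §4.9] [cite: NeukirchANT1999, Ch. III Thm. (2.6), (2.12), (2.17)]
[cite: SerreLocalFields1979, Ch. III §6 Prop. 13 and Remark]
-/

noncomputable section

open Set Function NumberField IsDedekindDomain Metric
open scoped Pointwise

namespace Summit.ABC.IUTFork.Joshi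

open Thm311 Thm311.Real Cor312 Cor312Vol Literature.IUT.LogThetaLattice Literature.IUT.LogVolume
  Literature.IUT.HodgeTheaters Literature.NumberTheory.NumberFields
open Literature.NumberTheory.GaloisRepresentations.Ultrametric

namespace GenuinePinsDiscriminant

/-! ## 1. Arithmetic: the different of a field all of whose ramification is `(2,1)` over `3` or `2` -/

section Arithmetic

variable {F : Type} [Field F] [NumberField F]

omit [NumberField F] in
/-- A finite place cannot contain both `2` and `3` (`3 − 2 = 1`). [folklore] -/
theorem not_mem_two_of_mem_three (v : HeightOneSpectrum (𝓞 F)) (h3 : ((3 : ℕ) : 𝓞 F) ∈ v.asIdeal)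
    (h2 : ((2 : ℕ) : 𝓞 F) ∈ v.asIdeal) : False := by
  have h1 : ((3 : ℕ) : 𝓞 F) - ((2 : ℕ) : 𝓞 F) ∈ v.asIdeal := v.asIdeal.sub_mem h3 h2
  have h1' : (1 : 𝓞 F) ∈ v.asIdeal := by
    have : ((3 : ℕ) : 𝓞 F) - ((2 : ℕ) : 𝓞 F) = 1 := by push_cast; norm_num
    rwa [this] at h1
  exact v.isPrime.ne_top ((Ideal.eq_top_iff_one _).mpr h1')

/-- **Tame `(2,1)`-place over `3`: `ord_v 𝔇_{F/ℤ} ≤ 1`** (Dedekind–Hensel `ord_v 𝔇 + 1 ≤ e·(v_3(e) + 1)` with `e = 2`, `v_3(2) = 0`).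
[cite: SerreLocalFields1979, Ch. III §6 Prop. 13 and Remark] [cite: NeukirchANT1999, Ch. III Thm. (2.6)] -/
theorem multiplicity_differentIdeal_le_one_of_three (v : HeightOneSpectrum (𝓞 F)) (hv : ((3 : ℕ) : 𝓞 F) ∈ v.asIdeal)
    (he : v.asIdeal.ramificationIdx ℤ = 2) : multiplicity v.asIdeal (differentIdeal ℤ (𝓞 F)) ≤ 1 := by
  haveI : Fact (Nat.Prime 3) := ⟨Nat.prime_three⟩
  have h := multiplicity_differentIdeal_int_succ_le F 3 v hv
  have h0 : padicValNat 3 2 = 0 := padicValNat.eq_zero_of_not_dvd (by norm_num)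
  rw [he, h0] at h
  omega

/-- **Wild `(2,1)`-place over `2`: `ord_v 𝔇_{F/ℤ} ≤ 3`** (Dedekind–Hensel with `e = 2`, `v_2(2) = 1`; the true exponent of the
`ℚ_2(√3)`-shape is `2`, not claimed). [cite: SerreLocalFields1979, Ch. III §6 Prop. 13 and Remark] [cite: NeukirchANT1999, Ch. III Thm. (2.6)] -/
theorem multiplicity_differentIdeal_le_three_of_two (v : HeightOneSpectrum (𝓞 F)) (hv : ((2 : ℕ) : 𝓞 F) ∈ v.asIdeal)
    (he : v.asIdeal.ramificationIdx ℤ = 2) : multiplicity v.asIdeal (differentIdeal ℤ (𝓞 F)) ≤ 3 := by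
  haveI : Fact (Nat.Prime 2) := ⟨Nat.prime_two⟩
  have h := multiplicity_differentIdeal_int_succ_le F 2 v hv
  rw [he, padicValNat_self] at h
  omega

/-- **Counting `(2,1)`-places over `p`**: `2·#S ≤ [F:ℚ]` for any set `S` of places `v ∋ p` with `e(v|p) f(v|p) = 2·1`
(`Σ_{v ∣ p} e_v f_v = [F:ℚ]`, tree `sum_localDeg`). [cite: NeukirchANT1999, Ch. II Prop. (8.5)] -/
theorem two_mul_card_le_finrank (p : ℕ) [Fact p.Prime] (S : Finset (HeightOneSpectrum (𝓞 F)))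
    (hS : ∀ v ∈ S, ((p : ℕ) : 𝓞 F) ∈ v.asIdeal ∧ v.asIdeal.ramificationIdx ℤ = 2 ∧ v.asIdeal.inertiaDeg ℤ = 1) :
    2 * S.card ≤ Module.finrank ℚ F := by
  have hsub : S ⊆ placesOver F p := fun v hv =>
    (mem_placesOver_iff v).mpr (liesOver_span_of_natCast_mem F p v (hS v hv).1)
  calc 2 * S.card = ∑ _v ∈ S, 2 := by rw [Finset.sum_const, smul_eq_mul, mul_comm]
    _ = ∑ v ∈ S, localDeg F v := Finset.sum_congr rfl fun v hv => by
        obtain ⟨-, he, hf⟩ := hS v hv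
        show 2 = v.asIdeal.ramificationIdx ℤ * v.asIdeal.inertiaDeg ℤ
        rw [he, hf]
    _ ≤ ∑ v ∈ placesOver F p, localDeg F v := Finset.sum_le_sum_of_subset hsub
    _ = Module.finrank ℚ F := sum_localDeg F p

/-- **THE DISCRIMINANT OF A FIELD WHOSE RAMIFICATION IS ALL `(2,1)` OVER `3` OR `2`**: if every finite place `v ∣ p` of `F` has `e(v|p) = 1`,
or `p = 3`, `(e, f) = (2, 1)`, or `p = 2`, `(e, f) = (2, 1)`, then `|d_F| ≤ 3^a·8^b` for some `a, b` with `2a ≤ [F:ℚ]`, `2b ≤ [F:ℚ]`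
(`a`, `b` = numbers of places over `3`, `2` dividing the different), and `b = 0` when `2` is unramified in `F`.  `|d_F| = N(𝔇_{F/ℤ}) =
∏_v N(v)^{ord_v 𝔇}`; `ord_v 𝔇 > 0 ⇒ e ≥ 2`; Dedekind–Hensel at the two shapes; `N(v) = p^f`.
[cite: NeukirchANT1999, Ch. III Thm. (2.6), (2.9)] [cite: SerreLocalFields1979, Ch. III §6 Prop. 13 and Remark] -/
theorem exists_natAbs_discr_le
    (hshape : ∀ (p : ℕ) [Fact p.Prime] (v : HeightOneSpectrum (𝓞 F)), ((p : ℕ) : 𝓞 F) ∈ v.asIdeal →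
      v.asIdeal.ramificationIdx ℤ = 1 ∨ (p = 3 ∧ v.asIdeal.ramificationIdx ℤ = 2 ∧ v.asIdeal.inertiaDeg ℤ = 1) ∨
        (p = 2 ∧ v.asIdeal.ramificationIdx ℤ = 2 ∧ v.asIdeal.inertiaDeg ℤ = 1)) :
    ∃ a b : ℕ, (NumberField.discr F).natAbs ≤ 3 ^ a * 8 ^ b ∧ 2 * a ≤ Module.finrank ℚ F ∧ 2 * b ≤ Module.finrank ℚ F ∧
      ((∀ v : HeightOneSpectrum (𝓞 F), ((2 : ℕ) : 𝓞 F) ∈ v.asIdeal → v.asIdeal.ramificationIdx ℤ = 1) → b = 0) := by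
  classical
  set D := differentIdeal ℤ (𝓞 F) with hDdef
  have hD : D ≠ ⊥ := differentIdeal_ne_bot' F
  set T : Finset (HeightOneSpectrum (𝓞 F)) := (finite_setOf_multiplicity_ne_zero F hD).toFinset with hT
  have hmemT : ∀ v, v ∈ T ↔ multiplicity v.asIdeal D ≠ 0 := fun v => by
    rw [hT, Set.Finite.mem_toFinset]; rfl
  -- the support of the different: `(2,1)`-places over `3` or over `2`
  have hcls : ∀ v ∈ T, (((3 : ℕ) : 𝓞 F) ∈ v.asIdeal ∧ v.asIdeal.ramificationIdx ℤ = 2 ∧ v.asIdeal.inertiaDeg ℤ = 1) ∨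
      (((2 : ℕ) : 𝓞 F) ∈ v.asIdeal ∧ v.asIdeal.ramificationIdx ℤ = 2 ∧ v.asIdeal.inertiaDeg ℤ = 1) := by
    intro v hv
    have hm : 0 < multiplicity v.asIdeal D := Nat.pos_of_ne_zero ((hmemT v).mp hv)
    have he2 : 2 ≤ v.asIdeal.ramificationIdx ℤ := two_le_ramificationIdx_int_of_multiplicity_pos (K := F) v hm
    haveI : Fact (residueChar F v).Prime := ⟨residueChar_prime F v⟩
    have hpv : ((residueChar F v : ℕ) : 𝓞 F) ∈ v.asIdeal := natCast_residueChar_mem F v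
    rcases hshape (residueChar F v) v hpv with h1 | ⟨hp3, he, hf⟩ | ⟨hp2, he, hf⟩
    · omega
    · exact Or.inl ⟨hp3 ▸ hpv, he, hf⟩
    · exact Or.inr ⟨hp2 ▸ hpv, he, hf⟩
  set T₃ := T.filter (fun v => ((3 : ℕ) : 𝓞 F) ∈ v.asIdeal) with hT₃
  set T₂ := T.filter (fun v => ((2 : ℕ) : 𝓞 F) ∈ v.asIdeal) with hT₂
  refine ⟨T₃.card, T₂.card, ?_, ?_, ?_, ?_⟩
  · -- `|d_F| = ∏_{v ∈ T} N(v)^{ord_v 𝔇} ≤ 3^{#T₃}·8^{#T₂}`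
    have hfac : ∏ v ∈ T, v.asIdeal ^ multiplicity v.asIdeal D = D := by
      rw [← finprod_eq_prod_of_mulSupport_subset
        (fun v : HeightOneSpectrum (𝓞 F) => v.asIdeal ^ multiplicity v.asIdeal D)]
      · exact Ideal.finprod_heightOneSpectrum_pow_multiplicity hD
      · intro v hv
        rw [Function.mem_mulSupport] at hv
        rw [Finset.mem_coe, hmemT]
        exact fun h => hv (by rw [h, pow_zero])
    have hnorm : (NumberField.discr F).natAbs = ∏ v ∈ T, Ideal.absNorm v.asIdeal ^ multiplicity v.asIdeal D := by
      rw [← NumberField.absNorm_differentIdeal F (𝓞 F), ← hDdef]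
      conv_lhs => rw [← hfac]
      rw [map_prod]
      simp only [map_pow]
    rw [hnorm]
    have hle : ∀ v ∈ T, Ideal.absNorm v.asIdeal ^ multiplicity v.asIdeal D ≤
        (if ((3 : ℕ) : 𝓞 F) ∈ v.asIdeal then 3 else 1) * (if ((2 : ℕ) : 𝓞 F) ∈ v.asIdeal then 8 else 1) := by
      intro v hv
      rcases hcls v hv with ⟨h3, he, hf⟩ | ⟨h2, he, hf⟩
      · haveI : Fact (Nat.Prime 3) := ⟨Nat.prime_three⟩
        have hN : Ideal.absNorm v.asIdeal = 3 := by rw [absNorm_eq_pow_inertiaDeg F 3 v h3, hf, pow_one]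
        have hm := multiplicity_differentIdeal_le_one_of_three v h3 he
        have h2' : ((2 : ℕ) : 𝓞 F) ∉ v.asIdeal := fun h2 => not_mem_two_of_mem_three v h3 h2
        rw [hN, if_pos h3, if_neg h2', mul_one]
        calc 3 ^ multiplicity v.asIdeal D ≤ 3 ^ 1 := Nat.pow_le_pow_right (by norm_num) hm
          _ = 3 := pow_one 3
      · haveI : Fact (Nat.Prime 2) := ⟨Nat.prime_two⟩
        have hN : Ideal.absNorm v.asIdeal = 2 := by rw [absNorm_eq_pow_inertiaDeg F 2 v h2, hf, pow_one]
        have hm := multiplicity_differentIdeal_le_three_of_two v h2 he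
        have h3' : ((3 : ℕ) : 𝓞 F) ∉ v.asIdeal := fun h3 => not_mem_two_of_mem_three v h3 h2
        rw [hN, if_neg h3', if_pos h2, one_mul]
        calc 2 ^ multiplicity v.asIdeal D ≤ 2 ^ 3 := Nat.pow_le_pow_right (by norm_num) hm
          _ = 8 := by norm_num
    calc ∏ v ∈ T, Ideal.absNorm v.asIdeal ^ multiplicity v.asIdeal D
        ≤ ∏ v ∈ T, ((if ((3 : ℕ) : 𝓞 F) ∈ v.asIdeal then 3 else 1) * (if ((2 : ℕ) : 𝓞 F) ∈ v.asIdeal then 8 else 1)) :=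
          Finset.prod_le_prod' hle
      _ = 3 ^ T₃.card * 8 ^ T₂.card := by
          rw [Finset.prod_mul_distrib, ← Finset.prod_filter, ← Finset.prod_filter, Finset.prod_const, Finset.prod_const]
  · haveI : Fact (Nat.Prime 3) := ⟨Nat.prime_three⟩
    refine two_mul_card_le_finrank 3 T₃ fun v hv => ?_
    rw [hT₃, Finset.mem_filter] at hv
    rcases hcls v hv.1 with ⟨h3, he, hf⟩ | ⟨h2, -, -⟩
    · exact ⟨h3, he, hf⟩
    · exact (not_mem_two_of_mem_three v hv.2 h2).elim
  · haveI : Fact (Nat.Prime 2) := ⟨Nat.prime_two⟩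
    refine two_mul_card_le_finrank 2 T₂ fun v hv => ?_
    rw [hT₂, Finset.mem_filter] at hv
    rcases hcls v hv.1 with ⟨h3, -, -⟩ | ⟨h2, he, hf⟩
    · exact (not_mem_two_of_mem_three v h3 hv.2).elim
    · exact ⟨h2, he, hf⟩
  · intro h2all
    rw [hT₂, Finset.card_eq_zero, Finset.filter_eq_empty_iff]
    intro v hv h2
    rcases hcls v hv with ⟨h3, -, -⟩ | ⟨-, he, -⟩
    · exact not_mem_two_of_mem_three v h3 h2
    · have := h2all v h2
      omega

/-- **Weak Minkowski beats `3^{n/2}`**: for `[F:ℚ] ≥ 3`, `3^[F:ℚ] < d_F²` (Mathlib `NumberField.abs_discr_ge`: `(4/9)(3π/4)^n ≤ |d_F|`;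
`(3π/4)² > 5.5` from `π > 3.14`; `(16/81)·(11/6)^n ≥ (16/81)(11/6)³ > 1`). [cite: NeukirchANT1999, Ch. III Thm. (2.17)] -/
theorem three_pow_lt_natAbs_discr_sq (hF : 3 ≤ Module.finrank ℚ F) :
    3 ^ Module.finrank ℚ F < (NumberField.discr F).natAbs ^ 2 := by
  set n := Module.finrank ℚ F with hn
  have hmink := NumberField.abs_discr_ge (K := F) (by omega)
  have hπ : (3.14 : ℝ) < Real.pi := Real.pi_gt_d2
  have hpos : (0 : ℝ) < 4 / 9 * (3 * Real.pi / 4) ^ n := by positivity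
  -- `(3π/4)² ≥ 5.5 = (11/6)·3`
  have hsq : (11 / 6 * 3 : ℝ) ≤ (3 * Real.pi / 4) ^ 2 := by nlinarith
  have hcube : ((11 : ℝ) / 6) ^ 3 ≤ (11 / 6) ^ n := pow_le_pow_right₀ (by norm_num) hF
  have hkey : (3 : ℝ) ^ n < (4 / 9 * (3 * Real.pi / 4) ^ n) ^ 2 := by
    have h1 : (4 / 9 * (3 * Real.pi / 4) ^ n) ^ 2 = 16 / 81 * ((3 * Real.pi / 4) ^ 2) ^ n := by
      have hx : ∀ x : ℝ, (4 / 9 * x ^ n) ^ 2 = 16 / 81 * (x ^ 2) ^ n := fun x => by ring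
      exact hx _
    have h2 : (11 / 6 * 3 : ℝ) ^ n ≤ ((3 * Real.pi / 4) ^ 2) ^ n :=
      pow_le_pow_left₀ (by norm_num) hsq n
    have h3 : (11 / 6 * 3 : ℝ) ^ n = (11 / 6) ^ n * 3 ^ n := mul_pow _ _ _
    have h4 : (0 : ℝ) < 3 ^ n := by positivity
    rw [h1]
    calc (3 : ℝ) ^ n < 16 / 81 * ((11 / 6) ^ 3) * 3 ^ n := by nlinarith
      _ ≤ 16 / 81 * ((11 / 6) ^ n * 3 ^ n) := by nlinarith
      _ = 16 / 81 * (11 / 6 * 3 : ℝ) ^ n := by rw [h3]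
      _ ≤ 16 / 81 * ((3 * Real.pi / 4) ^ 2) ^ n := by nlinarith
  have hreal : (3 : ℝ) ^ n < ((NumberField.discr F).natAbs : ℝ) ^ 2 := by
    rw [Nat.cast_natAbs]
    calc (3 : ℝ) ^ n < (4 / 9 * (3 * Real.pi / 4) ^ n) ^ 2 := hkey
      _ ≤ ((|NumberField.discr F| : ℤ) : ℝ) ^ 2 := pow_le_pow_left₀ hpos.le hmink 2
  exact_mod_cast hreal

end Arithmetic

end GenuinePinsDiscriminant

open GenuinePinsDiscriminant

/-! ## 2. At `settingPrVolSharp`: the discriminant of a field with inhabited pins -/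

variable {F : Type} [Field F] [NumberField F] (X : PilotData F)
  (M : Type) [Field M] [NumberField M]
  (archPk : ∀ (j : (thetaIndex X).Label) (vQ : (thetaIndex X).VQ), Set ((logShellsDH X (analyticLogv F)).Packet j vQ))
  (archSub : ∀ (j : (thetaIndex X).Label) (v : (thetaIndex X).V),
    Set ((logShellsDH X (analyticLogv F)).Packet j ((thetaIndex X).over v)))
  (Ψ : ℤ → ∀ v : (thetaIndex X).V, v ∈ (thetaIndex X).Vbad → Set ((logShellsDH X (analyticLogv F)).StarPacket v))
  (act : ℤ → ∀ v : (thetaIndex X).V, v ∈ (thetaIndex X).Vbad →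
    (logShellsDH X (analyticLogv F)).StarPacket v → Module.End ℚ ((logShellsDH X (analyticLogv F)).StarPacket v))
  (Mmod : ℤ → ∀ j : (thetaIndex X).LabelStar, Set ((logShellsDH X (analyticLogv F)).GlobalPacket j.1))
  (region : ℤ → ∀ j : (thetaIndex X).LabelStar, FinDivisor M → ∀ vQ : (thetaIndex X).VQ,
    Set ((logShellsDH X (analyticLogv F)).Packet j.1 vQ))
  (frobAdm : ℤ → ℤ → ∀ (j : (thetaIndex X).Label) (vQ : (thetaIndex X).VQ),
    Set ((logShellsDH X (analyticLogv F)).Packet j vQ) → Prop)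
  (frobLogvol : ℤ → ℤ → ∀ (j : (thetaIndex X).Label) (vQ : (thetaIndex X).VQ),
    Set ((logShellsDH X (analyticLogv F)).Packet j vQ) → ℝ)
  (frobΨ : ℤ → ℤ → ∀ v : (thetaIndex X).V, v ∈ (thetaIndex X).Vbad → Set ((logShellsDH X (analyticLogv F)).StarPacket v))
  (frobMmod : ℤ → ℤ → ∀ j : (thetaIndex X).LabelStar, Set ((logShellsDH X (analyticLogv F)).GlobalPacket j.1))
  (unitImage : ℤ → ℤ → ℕ → ∀ (j : (thetaIndex X).Label) (vQ : (thetaIndex X).VQ),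
    Set ((logShellsDH X (analyticLogv F)).Packet j vQ))
  (ballImage : ℤ → ℤ → ∀ (j : (thetaIndex X).Label) (vQ : (thetaIndex X).VQ),
    Set ((logShellsDH X (analyticLogv F)).Packet j vQ))
  (thetaDiv : ℤ → ℤ → LgpDivisor M (thetaIndex X).lstar)
  (n : ℤ) {HT : Type} {LogLink : HT → HT → Type} {IsFull : ∀ {s t : HT}, LogLink s t → Prop}
  (lat : LGPGaussianLogThetaLattice LogLink IsFull)
  {Frd : Type} {IsoF : Frd → Frd → Type} {Ob : Frd → Type} {realify : Frd → Frd} {Strip : Type}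
  {IsoS : Strip → Strip → Type} {Mv : ∀ v : (thetaIndex X).V, v ∈ (thetaIndex X).Vbad → Type}
  [∀ v h, Monoid (Mv v h)]
  (sig : GlobalLGPFrobenioidSignature (thetaIndex X).lstar (thetaIndex X).V (· ∈ (thetaIndex X).Vbad)
    Frd IsoF Ob realify Strip IsoS Mv)
  (split : SplittingMonoids Mv) {ObΔ : Type} {N : ∀ v : (thetaIndex X).V, v ∈ (thetaIndex X).Vbad → Type}
  [∀ v h, Monoid (N v h)] (qData : QPilotData ObΔ N)
  (t : ∀ (pp : Nat.Primes) (_ : Fin X.lstar) (x : (thetaIndex X).Fibre (.inr pp)),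
    haveI : Fact (pp : ℕ).Prime := ⟨pp.2⟩; kOf X pp.1 x)
  (tq : ∀ (pp : Nat.Primes) (x : (thetaIndex X).Fibre (.inr pp)), haveI : Fact (pp : ℕ).Prime := ⟨pp.2⟩; kOf X pp.1 x)
  (ρ : (∀ v : (thetaIndex X).V, v ∈ (thetaIndex X).Vbad → Set ((logShellsDH X (analyticLogv F)).StarPacket v)) →
    ∀ (j : (thetaIndex X).Label) (vQ : (thetaIndex X).VQ), Set ((logShellsDH X (analyticLogv F)).Packet j vQ))
  (qK : ∀ v : (thetaIndex X).V, v ∈ (thetaIndex X).Vbad → Set ((logShellsDH X (analyticLogv F)).StarPacket v))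
  (htq0 : ∀ pp x, tq pp x ≠ 0)
  (htq1 : ∀ (pp : Nat.Primes) (x : (thetaIndex X).Fibre (.inr pp)),
    haveI : Fact (pp : ℕ).Prime := ⟨pp.2⟩; placeOf X pp.1 x ∉ X.S → ‖tq pp x‖ = 1)

/-- **Pins ⇒ `d_F² ≤ 24^[F:ℚ]`** (root discriminant `≤ √24`): `PinnedRegions` at `settingPrVolSharp` (analytic logarithms; any `X`, `ρ`, `qK`,
column data, `Ψ`, ideles, column) bounds the discriminant of `F` — p489924 (B2) + §1.  The arithmetic input of E-ROW R-23's Minkowski ceiling.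
[cite: DupuyHilado2025, §4.9] [cite: NeukirchANT1999, Ch. III Thm. (2.6), (2.9)] [claim: Mochizuki2012, status: disputed] -/
theorem natAbs_discr_sq_le_of_pinnedRegions_settingPrVolSharp
    (hpin : Cor312Vol.PinnedRegions
      (LatticeSituation.ofShells (logShellsDH X (analyticLogv F)) M archPk archSub
        (summandPiecesPr X (logvAnalytic_analyticLogv (F := F))).Adm
        (summandPiecesPr X (logvAnalytic_analyticLogv (F := F))).logvol Ψ act Mmod region frobAdm frobLogvol frobΨ frobMmod
        unitImage ballImage thetaDiv)
      (settingPrVolSharp X (logvAnalytic_analyticLogv (F := F)) M archPk archSub Ψ act Mmod region n lat sig split qData tq t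
        htq0 htq1) ρ qK) :
    (NumberField.discr F).natAbs ^ 2 ≤ 24 ^ Module.finrank ℚ F := by
  obtain ⟨a, b, hd, ha, hb, -⟩ := exists_natAbs_discr_le (F := F) (fun p _ v hv => by
    rcases localShape_of_pinnedRegions_settingPrVolSharp X M archPk archSub Ψ act Mmod region frobAdm frobLogvol frobΨ frobMmod unitImage ballImage thetaDiv n lat sig split qData t tq ρ qK htq0 htq1 hpin p v hv with
      ⟨h1, -⟩ | ⟨hp3, he, hf, -⟩ | ⟨hp2, he, hf, -, -⟩
    · exact Or.inl h1
    · exact Or.inr (Or.inl ⟨hp3, he, hf⟩)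
    · exact Or.inr (Or.inr ⟨hp2, he, hf⟩))
  calc (NumberField.discr F).natAbs ^ 2 ≤ (3 ^ a * 8 ^ b) ^ 2 := Nat.pow_le_pow_left hd 2
    _ = 3 ^ (2 * a) * 8 ^ (2 * b) := by ring
    _ ≤ 3 ^ Module.finrank ℚ F * 8 ^ Module.finrank ℚ F :=
        Nat.mul_le_mul (Nat.pow_le_pow_right (by norm_num) ha) (Nat.pow_le_pow_right (by norm_num) hb)
    _ = 24 ^ Module.finrank ℚ F := by rw [← mul_pow]; norm_num

/-- **Pins and `2` unramified in `F` ⇒ `d_F² ≤ 3^[F:ℚ]`** (only tame `(2,1)`-places over `3` divide the different, each once).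
[cite: DupuyHilado2025, §4.9] [cite: NeukirchANT1999, Ch. III Thm. (2.6), (2.9)] [claim: Mochizuki2012, status: disputed] -/
theorem natAbs_discr_sq_le_three_pow_of_pinnedRegions_settingPrVolSharp
    (hpin : Cor312Vol.PinnedRegions
      (LatticeSituation.ofShells (logShellsDH X (analyticLogv F)) M archPk archSub
        (summandPiecesPr X (logvAnalytic_analyticLogv (F := F))).Adm
        (summandPiecesPr X (logvAnalytic_analyticLogv (F := F))).logvol Ψ act Mmod region frobAdm frobLogvol frobΨ frobMmod
        unitImage ballImage thetaDiv)
      (settingPrVolSharp X (logvAnalytic_analyticLogv (F := F)) M archPk archSub Ψ act Mmod region n lat sig split qData tq t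
        htq0 htq1) ρ qK)
    (h2 : ∀ v : HeightOneSpectrum (𝓞 F), ((2 : ℕ) : 𝓞 F) ∈ v.asIdeal → v.asIdeal.ramificationIdx ℤ = 1) :
    (NumberField.discr F).natAbs ^ 2 ≤ 3 ^ Module.finrank ℚ F := by
  obtain ⟨a, b, hd, ha, -, hb0⟩ := exists_natAbs_discr_le (F := F) (fun p _ v hv => by
    rcases localShape_of_pinnedRegions_settingPrVolSharp X M archPk archSub Ψ act Mmod region frobAdm frobLogvol frobΨ frobMmod unitImage ballImage thetaDiv n lat sig split qData t tq ρ qK htq0 htq1 hpin p v hv with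
      ⟨h1, -⟩ | ⟨hp3, he, hf, -⟩ | ⟨hp2, he, hf, -, -⟩
    · exact Or.inl h1
    · exact Or.inr (Or.inl ⟨hp3, he, hf⟩)
    · exact Or.inr (Or.inr ⟨hp2, he, hf⟩))
  rw [hb0 h2, pow_zero, mul_one] at hd
  calc (NumberField.discr F).natAbs ^ 2 ≤ (3 ^ a) ^ 2 := Nat.pow_le_pow_left hd 2
    _ = 3 ^ (2 * a) := by ring
    _ ≤ 3 ^ Module.finrank ℚ F := Nat.pow_le_pow_right (by norm_num) ha

/-! ## 3. Every `F ≠ ℚ` in which `2` is unramified has EMPTY pins -/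

/-- **EVERY NUMBER FIELD `F ≠ ℚ` IN WHICH `2` IS UNRAMIFIED (`e(v|2) = 1` at every `v ∣ 2`): `PinnedRegions` FAILS at `settingPrVolSharp`**
for the analytic logarithms — every `X : PilotData F`, `ρ`, `qK`, column data, `Ψ`, ideles, column; every degree (`[F:ℚ] = 2`: abc-iut-E-t43's
p461949; `[F:ℚ] ≥ 3`: `d_F² ≤ 3^n` from the pins against Minkowski's `d_F² > 3^n`). [cite: DupuyHilado2025, §4.9]
[cite: NeukirchANT1999, Ch. III Thm. (2.6), (2.17)] [claim: Mochizuki2012, status: disputed] -/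
theorem not_pinnedRegions_settingPrVolSharp_of_unramified_two (hF : 1 < Module.finrank ℚ F)
    (h2 : ∀ v : HeightOneSpectrum (𝓞 F), ((2 : ℕ) : 𝓞 F) ∈ v.asIdeal → v.asIdeal.ramificationIdx ℤ = 1) :
    ¬ Cor312Vol.PinnedRegions
      (LatticeSituation.ofShells (logShellsDH X (analyticLogv F)) M archPk archSub
        (summandPiecesPr X (logvAnalytic_analyticLogv (F := F))).Adm
        (summandPiecesPr X (logvAnalytic_analyticLogv (F := F))).logvol Ψ act Mmod region frobAdm frobLogvol frobΨ frobMmod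
        unitImage ballImage thetaDiv)
      (settingPrVolSharp X (logvAnalytic_analyticLogv (F := F)) M archPk archSub Ψ act Mmod region n lat sig split qData tq t
        htq0 htq1) ρ qK := by
  intro hpin
  by_cases hF2 : Module.finrank ℚ F = 2
  · exact not_pinnedRegions_settingPrVolSharp_of_finrank_eq_two X M archPk archSub Ψ act Mmod region frobAdm frobLogvol frobΨ frobMmod unitImage ballImage thetaDiv n lat sig split qData t tq ρ qK htq0 htq1 hF2 hpin
  · have hF3 : 3 ≤ Module.finrank ℚ F := by omega
    have hle := natAbs_discr_sq_le_three_pow_of_pinnedRegions_settingPrVolSharp X M archPk archSub Ψ act Mmod region frobAdm frobLogvol frobΨ frobMmod unitImage ballImage thetaDiv n lat sig split qData t tq ρ qK htq0 htq1 hpin h2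
    have hlt := three_pow_lt_natAbs_discr_sq (F := F) hF3
    omega

/-- The same for `PinnedRegions3`. [claim: Mochizuki2012, status: disputed] -/
theorem not_pinnedRegions3_settingPrVolSharp_of_unramified_two (hF : 1 < Module.finrank ℚ F)
    (h2 : ∀ v : HeightOneSpectrum (𝓞 F), ((2 : ℕ) : 𝓞 F) ∈ v.asIdeal → v.asIdeal.ramificationIdx ℤ = 1) :
    ¬ Cor312Vol.PinnedRegions3
      (LatticeSituation.ofShells (logShellsDH X (analyticLogv F)) M archPk archSub
        (summandPiecesPr X (logvAnalytic_analyticLogv (F := F))).Adm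
        (summandPiecesPr X (logvAnalytic_analyticLogv (F := F))).logvol Ψ act Mmod region frobAdm frobLogvol frobΨ frobMmod
        unitImage ballImage thetaDiv)
      (settingPrVolSharp X (logvAnalytic_analyticLogv (F := F)) M archPk archSub Ψ act Mmod region n lat sig split qData tq t
        htq0 htq1) ρ qK :=
  fun h => not_pinnedRegions_settingPrVolSharp_of_unramified_two X M archPk archSub Ψ act Mmod region frobAdm frobLogvol frobΨ frobMmod unitImage ballImage thetaDiv n lat sig split qData t tq ρ qK htq0 htq1 hF h2 h.1

/-- **EVERY NUMBER FIELD `F ≠ ℚ` WITH ODD DISCRIMINANT (`2 ∤ d_F`): `PinnedRegions` FAILS at `settingPrVolSharp`** — `2 ∤ d_F` iff `2` is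
unramified in `F` (Dedekind; Mathlib `NumberField.not_dvd_discr_iff_forall_mem`, `Ideal.ramificationIdx_eq_one_iff`).
[cite: NeukirchANT1999, Ch. III Thm. (2.12)] [cite: DupuyHilado2025, §4.9] [claim: Mochizuki2012, status: disputed] -/
theorem not_pinnedRegions_settingPrVolSharp_of_not_two_dvd_discr (hF : 1 < Module.finrank ℚ F)
    (h2 : ¬ (2 : ℤ) ∣ NumberField.discr F) :
    ¬ Cor312Vol.PinnedRegions
      (LatticeSituation.ofShells (logShellsDH X (analyticLogv F)) M archPk archSub
        (summandPiecesPr X (logvAnalytic_analyticLogv (F := F))).Adm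
        (summandPiecesPr X (logvAnalytic_analyticLogv (F := F))).logvol Ψ act Mmod region frobAdm frobLogvol frobΨ frobMmod
        unitImage ballImage thetaDiv)
      (settingPrVolSharp X (logvAnalytic_analyticLogv (F := F)) M archPk archSub Ψ act Mmod region n lat sig split qData tq t
        htq0 htq1) ρ qK := by
  refine not_pinnedRegions_settingPrVolSharp_of_unramified_two X M archPk archSub Ψ act Mmod region frobAdm frobLogvol frobΨ frobMmod unitImage ballImage thetaDiv n lat sig split qData t tq ρ qK htq0 htq1 hF fun v hv => ?_
  have hunr := (NumberField.not_dvd_discr_iff_forall_mem F (𝓞 F) Int.prime_two).mp h2 v.asIdeal v.isPrime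
    (by exact_mod_cast hv)
  haveI : v.asIdeal.IsMaximal := v.isMaximal
  exact Ideal.ramificationIdx_eq_one_iff.mpr hunr

/-- The same for `PinnedRegions3`. [claim: Mochizuki2012, status: disputed] -/
theorem not_pinnedRegions3_settingPrVolSharp_of_not_two_dvd_discr (hF : 1 < Module.finrank ℚ F)
    (h2 : ¬ (2 : ℤ) ∣ NumberField.discr F) :
    ¬ Cor312Vol.PinnedRegions3
      (LatticeSituation.ofShells (logShellsDH X (analyticLogv F)) M archPk archSub
        (summandPiecesPr X (logvAnalytic_analyticLogv (F := F))).Adm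
        (summandPiecesPr X (logvAnalytic_analyticLogv (F := F))).logvol Ψ act Mmod region frobAdm frobLogvol frobΨ frobMmod
        unitImage ballImage thetaDiv)
      (settingPrVolSharp X (logvAnalytic_analyticLogv (F := F)) M archPk archSub Ψ act Mmod region n lat sig split qData tq t
        htq0 htq1) ρ qK :=
  fun h => not_pinnedRegions_settingPrVolSharp_of_not_two_dvd_discr X M archPk archSub Ψ act Mmod region frobAdm frobLogvol frobΨ frobMmod unitImage ballImage thetaDiv n lat sig split qData t tq ρ qK htq0 htq1 hF h2 h.1

end Summit.ABC.IUTFork.Joshi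

end
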